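/-
Copyright (c) 2026 the pub-hodgecm-mathlib formalisation cell (harness21).  Prover seat hodgecm-mathlib-F0P2-p07 (g0), strike line L1
`stub_firstTermThetaPairing` (LEAD F0P6-plan (g14), BATCH #56: «ramified hmid + (C3-κ) = F0P2-p07»; desk∕lead of the (M2a) chain K2Liu-p01 (g10)):
Track B «K2-LIT», hLiu418 = stmt-HodgeConjecture-24832, road `K2_Liu`, socket #42S, organ S1, (G) organ ROW (ρ-mid), brick (C3-κ): THE FRAME COORDINATE `κ`
OF THE LATTICE-PAIR WITNESS ALONG A TRANSPORTED SIEGEL LEVI — `κ(B·x)` row by row from (K1).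
-/
import Summits.HodgeConjecture.HodgeConjecture.Theorems.K2LiuLocalSWTensorAdaptedBlocks   -- ★ F5c-A `matA_tensorEmbLoc`, `blk_reindex_kronecker`, `isSiegelDelta_tensorEmbLoc`
import Literature.NumberTheory.GelbartRogawski1991.LocalDoubledUnitaryLagrangians          -- ★ `eD`, `eD_matA_mulVec`, `iotaD`, `toLin`
import Literature.NumberTheory.GelbartRogawski1991.LocalDoubledUnitaryIwahori              -- ★ `isSiegelDelta_iff_blkC_eq_zero`
import Literature.RepresentationTheory.HeisenbergGroup.SymplecticMatrixTransport           -- ★ `transportSp`, `coe_transportSp_apply`, `darboux`, `glEquiv`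
import Literature.RepresentationTheory.HeisenbergGroup.SymplecticSiegelGeneration          -- ★ `levi`, `coe_levi`
import HarnessLib

/-!
# Crux `HLiu418`, #42S organ S1, (G) organ ROW (ρ-mid), brick (C3-κ): THE WITNESS COORDINATE `κ` ALONG A TRANSPORTED SIEGEL LEVI

Cell `hodgecm-mathlib`, crux item hLiu418 = `stmt-HodgeConjecture-24832`; squad K2 ∕ K2Liu; LEAD F0P6-plan (g14); (M2a) lead K2Liu-p01 (g10); prover F0P2-p07 (g0).
THEOREMS ONLY (no `def`, no instance, no notation, no named-fact hypothesis, no `sorry`); lane `--supports stmt-HodgeConjecture-24832 --as helper`.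

WHY.  In the (ρ-mid) middle-profile chain (M2a) (★ (M1) p861514 → ★ (C1) p861833 → ★ (C2a∕C2b′) p861996∕p862139 → (C2c) → (C3)), the Levi step (C3) moves a Siegel
element `p ∈ P_Δ(H_v)` through the witness's implementer `E′` (★ (C3-a) `K2LiuBlockImplementerLeviAction.toOp_localOmega_toOp_symm_eq_smul_leviOpPi`: given the
transported-Levi letter `hB : E′·ι(p ⊗ 1)·E′⁻¹ = transportSp 𝕋′ (m(B))`, the Weil action of `s_v(p ⊗ 1)` read through `Γ` is `χ_v(det_Δ p) · leviOpPi B`, i.e. the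
lattice-pair test function `𝟙_{κ⁻¹B₁} − 𝟙_{κ⁻¹B₂}` gets evaluated at `B⁻¹·y`).  To feed ★ (M2a-L) `K2LiuWitnessLeviReading(Uniformizer)` one must know `κ(B·y)` in terms of
`κ(y)`: THIS FILE proves it from the frame-coordinate letter (K1) of ★ (K-tot)∕★ (R-B″) ALONE —
**`kappa_levi_rows`**: under `hB` (for the TENSOR datum `𝕍 ⊗ V′`, `p ∈ P_Δ(U(𝕍□)_v)`), for every `x ∈ X`,
`(κ(B·x)).1 = D_p(w₀)·(κ x).1`, `(κ(B·x)).2.1 = D_p(w₀)·(κ x).2.1`, `(κ(B·x)).2.2 = D_p(w₀)·(κ x).2.2`, where `D_p = blkD (matA p)` is the `Δ⁻`-block of `p` (a `2 × 2`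
matrix over `L ⊗ L⁺_v`) read at `w₀` — «the Levi row of `κ`».  Steps (all ★ + linear algebra):
* §1 `rows_eq_mulVec_of_reading` — pure matrix algebra: if `![κ₁ x j, κ₂ x j, κ₃ x j]·P = R x j` with `P` invertible and `R x′ j l = Σ_{j′} D j j′ R x j′ l`, then
  `κ_i x′ = D·κ_i x` (`i = 1, 2, 3`);
* §2 `halfDiff_eD_symm_iotaD_of_blkC_eq_zero` — for a Siegel element `g` (`blkC (matA g) = 0`): `halfDiff (eD⁻¹ (ι(g) w)) = blkD (matA g) · halfDiff (eD⁻¹ w)`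
  (★ `eD_matA_mulVec`, ★ `mulVec_dblV_add_adblV`); `toLin_inv_apply_levi_mulVec` — under `hB`, `E′⁻¹ (B·x, 0) = ι(g) (E′⁻¹ (x, 0))` (★ `coe_transportSp_apply`, ★ `coe_levi`);
* §3 `reindex_kronecker_one_mulVec_apply` — `(reindex ε ε (D ⊗ₖ 1)·f)(ε(j,l)) = Σ_{j′} D j j′ f(ε(j′,l))`; with ★ F5c-A `matA_tensorEmbLoc`∕`blk_reindex_kronecker`
  (`blkD (matA (p ⊗ 1)) = reindex epsV epsV (blkD (matA p) ⊗ₖ 1)`) this gives the row relation for the reading `R x j l = halfDiff (eD⁻¹ (E′⁻¹ (x,0))) (epsV (j,l)) w₀`;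
* §4 the assembly `kappa_levi_rows` in the (K1) bytes of ★ (R-B″) `K2LiuNonsplitWitnessReadingOfMover` (`n = 2`, `M₂ = 3`).
The consumer ((C3), K2Liu-p01) instantiates `(p, B) := (p⁻¹, B⁻¹)` for `leviOpPi`'s `B⁻¹·y` (`hB` inverts inside the group) and reads `D_{p⁻¹}(w₀)` for `p = m(a)`.
References: [Kudla1994] §3 Thm. 3.1; [HarrisKudlaSweet1996] §1 (1.11), (1.15); [MoeglinVignerasWaldspurger1987] Chap. 2 II.2; [Rangarao1993] Lemma 3.2 (3.8).
HONEST LABEL.  Count-neutral helper: `HC_CM` is proved only modulo the 7 printed citations (2 remaining named inputs: hLiu418 = `stmt-HodgeConjecture-24832`,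
h413 = `stmt-HodgeConjecture-24833`) until rung 0 closes.  NOT here: `hB` itself ((C2c)∕(C3), K2Liu-p01), the Levi reading ★ (M2a-L), ★ (M2b), the (G) assembly.

## References
* [Kudla1994] S. S. Kudla, Israel J. Math. 87 (1994), §3 Thm. 3.1.
* [HarrisKudlaSweet1996] M. Harris, S. Kudla, W. J. Sweet, J. Amer. Math. Soc. 9 (1996), §1 (1.11), (1.15).
* [MoeglinVignerasWaldspurger1987] C. Mœglin, M.-F. Vignéras, J.-L. Waldspurger, LNM 1291 (1987), Chap. 2 II.2.
* [Rangarao1993] R. Ranga Rao, Pacific J. Math. 157 (1993), Lemma 3.2 (3.8).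
-/

set_option autoImplicit false
set_option linter.dupNamespace false -- the mandated namespace repeats `HodgeConjecture.HodgeConjecture`

noncomputable section

open scoped Matrix Kronecker
open NumberField IsDedekindDomain Matrix
open Literature.RepresentationTheory.HeisenbergGroup Literature.RepresentationTheory.HeisenbergGroup.SymplecticMatrix
open Literature.NumberTheory.Automorphic Literature.NumberTheory.Automorphic.UnitaryGroup
open Literature.NumberTheory.GelbartRogawski1991 Literature.NumberTheory.GelbartRogawski1991.GRConstruction
open Literature.NumberTheory.GelbartRogawski1991.UnitaryDualPair
open Literature.NumberTheory.GelbartRogawski1991.UnitaryDualPair.LocalSplitting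
open Literature.NumberTheory.GelbartRogawski1991.AdaptedBlocks
open Literature.NumberTheory.K2Lit.SiegelDoubled
open Summit.HodgeConjecture.HodgeConjecture.Cruxes.HLiu418.K2LiuLocalSWSectionDefs
open Summit.HodgeConjecture.HodgeConjecture.Cruxes.HLiu418.K2LiuLocalSWTensorAdaptedBlocks

namespace Summit.HodgeConjecture.HodgeConjecture.Cruxes.HLiu418.K2LiuWitnessCoordinateLeviRow

/-! ## §1 Pure matrix algebra: rows of `κ` from a row relation of the reading -/

section Rows

variable {K X : Type*} [Field K]

/-- **ROWS OF `κ` FROM THE READING**: if `![κ₁ x j, κ₂ x j, κ₃ x j] ᵥ* P = R x j` for an invertible `P` (the letter (K1)) and the reading of `x′` is the `D`-row-mix of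
the reading of `x` (`R x′ j l = Σ_{j′} D j j′ · R x j′ l`), then each coordinate vector of `x′` is `D` times that of `x`. [folklore] -/
theorem rows_eq_mulVec_of_reading (κ₁ κ₂ κ₃ : X → Fin 2 → K) (P : Matrix (Fin 3) (Fin 3) K) (hP : IsUnit P.det)
    (R : X → Fin 2 → Fin 3 → K) (hK1 : ∀ x j, ![κ₁ x j, κ₂ x j, κ₃ x j] ᵥ* P = R x j)
    (D : Matrix (Fin 2) (Fin 2) K) {x x' : X} (hR : ∀ j l, R x' j l = ∑ j', D j j' * R x j' l) :
    κ₁ x' = D *ᵥ κ₁ x ∧ κ₂ x' = D *ᵥ κ₂ x ∧ κ₃ x' = D *ᵥ κ₃ x := by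
  have hinv : ∀ y j, ![κ₁ y j, κ₂ y j, κ₃ y j] = R y j ᵥ* P⁻¹ := fun y j => by
    rw [← hK1 y j, Matrix.vecMul_vecMul, Matrix.mul_nonsing_inv _ hP, Matrix.vecMul_one]
  have key : ∀ (k : Fin 3) (κ : X → Fin 2 → K), (∀ y j, κ y j = (R y j ᵥ* P⁻¹) k) → κ x' = D *ᵥ κ x := by
    intro k κ hκ
    funext j
    rw [hκ x' j, Matrix.mulVec, dotProduct, Matrix.vecMul, dotProduct]
    simp_rw [hκ x, Matrix.vecMul, dotProduct, hR j, Finset.sum_mul, Finset.mul_sum]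
    rw [Finset.sum_comm]
    exact Finset.sum_congr rfl fun j' _ => Finset.sum_congr rfl fun l _ => by ring
  refine ⟨key 0 κ₁ fun y j => ?_, key 1 κ₂ fun y j => ?_, key 2 κ₃ fun y j => ?_⟩
  · have h := congrFun (hinv y j) 0
    simpa using h
  · have h := congrFun (hinv y j) 1
    simpa using h
  · have h := congrFun (hinv y j) 2
    simpa using h

/-- `(reindex ε ε (D ⊗ₖ 1) ·ᵥ f)(ε(j, l)) = Σ_{j′} D j j′ · f(ε(j′, l))` — a Kronecker row-mix acts on the first index only. [folklore] -/
theorem reindex_kronecker_one_mulVec_apply {R : Type*} [CommRing R] {ι κ ι' : Type*} [Fintype ι] [Fintype κ] [Fintype ι'] [DecidableEq κ]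
    (ε : ι × κ ≃ ι') (D : Matrix ι ι R) (f : ι' → R) (j : ι) (l : κ) :
    (Matrix.reindex ε ε (D ⊗ₖ (1 : Matrix κ κ R)) *ᵥ f) (ε (j, l)) = ∑ j', D j j' * f (ε (j', l)) := by
  rw [Matrix.mulVec, dotProduct, ← Equiv.sum_comp ε, Fintype.sum_prod_type]
  refine Finset.sum_congr rfl fun j' _ => ?_
  simp only [Matrix.reindex_apply, Matrix.submatrix_apply, Equiv.symm_apply_apply, Matrix.kroneckerMap_apply, Matrix.one_apply, mul_ite,
    mul_one, mul_zero, ite_mul, zero_mul]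
  rw [Finset.sum_ite_eq]
  simp

end Rows

/-! ## §2 A Siegel element through the frame `eD` and through a mover `E′` (generic doubled unitary datum) -/

section Doubled

variable (F : Type) [Field F] [NumberField F] (E : Type) [Field E] [NumberField E] [Algebra F E] [Algebra.IsQuadraticExtension F E]
  (c : E ≃ₐ[F] E) {δ : E} (hcδ : c δ = -δ) (hδ : δ ≠ 0) {d : F} (hd : δ * δ = algebraMap F E d)
  (v : HeightOneSpectrum (𝓞 F)) (n : ℕ) {T₀ : Matrix (Fin n) (Fin n) F} (hT₀ : T₀.IsSymm)
  {JD : Matrix (Fin (n + n)) (Fin (n + n)) E} (hJD : JD = (gramD F n T₀).map (algebraMap F E))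

/-- **A SIEGEL ELEMENT READ ON `Δ⁻`**: for `g` with `blkC (matA g) = 0` (i.e. `g ∈ P_Δ`, ★ `isSiegelDelta_iff_blkC_eq_zero`) and every `w ∈ 𝕎_v`,
`halfDiff (eD⁻¹ (ι(g) w)) = blkD (matA g) ·ᵥ halfDiff (eD⁻¹ w)` (★ `eD_matA_mulVec` + the adapted block decomposition ★ `mulVec_dblV_add_adblV`).
[cite: Kudla1994, §3] [cite: HarrisKudlaSweet1996, §1 (1.11)] -/
theorem halfDiff_eD_symm_iotaD_of_blkC_eq_zero (g : UnitaryGroup.localPi E c (n + n) JD v) (hg : blkC (matA F E c v n g) = 0)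
    (w : (Fin (n + n) → v.adicCompletion F) × (Fin (n + n) → v.adicCompletion F)) :
    halfDiff ((eD F E c hcδ hδ hd v n).symm (toLin F v (iotaD F E c hcδ hδ hd v n hT₀ hJD g) w)) =
      blkD (matA F E c v n g) *ᵥ halfDiff ((eD F E c hcδ hδ hd v n).symm w) := by
  have hw : w = eD F E c hcδ hδ hd v n ((eD F E c hcδ hδ hd v n).symm w) := ((eD F E c hcδ hδ hd v n).apply_symm_apply w).symm
  conv_lhs => rw [hw, ← eD_matA_mulVec F E c hcδ hδ hd v n hT₀ hJD g, LinearEquiv.symm_apply_apply,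
    ← dblV_halfSum_add_adblV_halfDiff ((eD F E c hcδ hδ hd v n).symm w), mulVec_dblV_add_adblV, halfDiff_dblV_add_adblV, hg,
    Matrix.zero_mulVec, zero_add]

/-- **THE POINT MOVED BY A TRANSPORTED LEVI**: if `E′·ι(g)·E′⁻¹ = transportSp 𝕋 (m(B))` (the letter `hB` of ★ (C3-a) `K2LiuBlockImplementerLeviAction`), then
`E′⁻¹ (B·x, 0) = ι(g) (E′⁻¹ (x, 0))` for every `x ∈ X` (`m(B)` acts on `X ⊕ Y` by `(x, y) ↦ (B x, 𝕋⁻¹B⁻ᵀ𝕋 y)`, ★ `coe_transportSp_apply`, ★ `coe_levi`).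
[cite: MoeglinVignerasWaldspurger1987, Chap. 2 II.2] [cite: Kudla1994, §3] -/
theorem toLin_inv_apply_levi_mulVec (hTv : IsUnit (localGram F (n + n) (gramD F n T₀) v).det) (E' : LocalSp F (n + n) (gramD F n T₀) v)
    (g : UnitaryGroup.localPi E c (n + n) JD v) (B : GL (Fin (n + n)) (v.adicCompletion F))
    (hB : E' * iotaD F E c hcδ hδ hd v n hT₀ hJD g * E'⁻¹ = transportSp (localGram F (n + n) (gramD F n T₀) v) hTv (levi B))
    (x : Fin (n + n) → v.adicCompletion F) :
    toLin F v E'⁻¹ ((B : Matrix (Fin (n + n)) (Fin (n + n)) (v.adicCompletion F)) *ᵥ x, 0) =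
      toLin F v (iotaD F E c hcδ hδ hd v n hT₀ hJD g) (toLin F v E'⁻¹ (x, 0)) := by
  have h1 : toLin F v (transportSp (localGram F (n + n) (gramD F n T₀) v) hTv (levi B)) (x, 0) =
      ((B : Matrix (Fin (n + n)) (Fin (n + n)) (v.adicCompletion F)) *ᵥ x, 0) := by
    change ((transportSp (localGram F (n + n) (gramD F n T₀) v) hTv (levi B) : symplecticGroup (polar (Matrix.toLinearMap₂' (v.adicCompletion F)
      (localGram F (n + n) (gramD F n T₀) v)))) : ((Fin (n + n) → v.adicCompletion F) × (Fin (n + n) → v.adicCompletion F)) ≃ₗ[v.adicCompletion F]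
      ((Fin (n + n) → v.adicCompletion F) × (Fin (n + n) → v.adicCompletion F))) (x, 0) = _
    rw [coe_transportSp_apply, SymplecticMatrix.darboux_apply, Matrix.mulVec_zero, coe_levi, Matrix.fromBlocks_mulVec, Sum.elim_comp_inl, Sum.elim_comp_inr,
      Matrix.mulVec_zero, Matrix.mulVec_zero, Matrix.zero_mulVec, add_zero, zero_add, SymplecticMatrix.darboux_symm_sumElim, Matrix.mulVec_zero]
  have h2 : E'⁻¹ * transportSp (localGram F (n + n) (gramD F n T₀) v) hTv (levi B) = iotaD F E c hcδ hδ hd v n hT₀ hJD g * E'⁻¹ := by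
    rw [← hB]; group
  have h3 : toLin F v E'⁻¹ (toLin F v (transportSp (localGram F (n + n) (gramD F n T₀) v) hTv (levi B)) (x, 0)) =
      toLin F v (iotaD F E c hcδ hδ hd v n hT₀ hJD g) (toLin F v E'⁻¹ (x, 0)) := by
    change ((E'⁻¹ * transportSp (localGram F (n + n) (gramD F n T₀) v) hTv (levi B) : LocalSp F (n + n) (gramD F n T₀) v) :
        ((Fin (n + n) → v.adicCompletion F) × (Fin (n + n) → v.adicCompletion F)) ≃ₗ[v.adicCompletion F]
        ((Fin (n + n) → v.adicCompletion F) × (Fin (n + n) → v.adicCompletion F))) (x, 0) =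
      ((iotaD F E c hcδ hδ hd v n hT₀ hJD g * E'⁻¹ : LocalSp F (n + n) (gramD F n T₀) v) :
        ((Fin (n + n) → v.adicCompletion F) × (Fin (n + n) → v.adicCompletion F)) ≃ₗ[v.adicCompletion F]
        ((Fin (n + n) → v.adicCompletion F) × (Fin (n + n) → v.adicCompletion F))) (x, 0)
    rw [h2]
  rw [← h1]
  exact h3

end Doubled

/-! ## §3 The tensor datum `𝕍 ⊗ V′` (`n = 2`, `M₂ = 3`): the Levi row of the frame coordinate `κ` -/

section Tensor

variable (L : Type) [Field L] [NumberField L] [IsCMField L]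
variable {N M : ℕ} (e : Fin N × Fin M ≃ Fin 2)
  (dV : Fin N → L) (hdV : ∀ i, IsCMField.complexConj L (dV i) = dV i)
  (dW : Fin M → L) (hdW : ∀ i, IsCMField.complexConj L (dW i) = dW i)
variable {M' n' : ℕ} (eW : Fin M × Fin 3 ≃ Fin M') (e' : Fin N × Fin M' ≃ Fin n')
  (dV' : Fin 3 → L) (hdV' : ∀ k, IsCMField.complexConj L (dV' k) = dV' k)
variable (v : HeightOneSpectrum (𝓞 (Fp L))) (w₀ : PlacesOver L v)

set_option maxHeartbeats 400000 in
/-- **THE READING ALONG A SIEGEL ELEMENT OF `U(𝕍□)_v`**: for `p ∈ P_Δ(U(𝕍□)_v)` and the letter `hB` at the TENSOR datum (`E′·ι′(p ⊗ 1)·E′⁻¹ = transportSp 𝕋′ (m(B))`),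
the `Δ⁻`-reading `R x j l := halfDiff (eD⁻¹ (E′⁻¹ (x, 0))) (epsV (j, l))` satisfies `R (B·x) j l = Σ_{j′} (blkD (matA p)) j j′ · R x j′ l` in `L ⊗ L⁺_v`.
[cite: Kudla1994, §3 Thm. 3.1] [cite: HarrisKudlaSweet1996, §1 (1.11), (1.15)] -/
theorem halfDiff_reading_levi_mulVec
    (hTv : IsUnit (localGram (Fp L) (n' + n') (gramD (Fp L) n' (gramR L e' dV hdV (tensorFrame L dW eW dV') (tensorFrame_real L dW hdW eW dV' hdV'))) v).det)
    (E' : LocalSp (Fp L) (n' + n') (gramD (Fp L) n' (gramR L e' dV hdV (tensorFrame L dW eW dV') (tensorFrame_real L dW hdW eW dV' hdV'))) v)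
    (p : UnitaryGroup.localPi L (IsCMField.complexConj L) (2 + 2) (hermD L e dV hdV dW hdW) v)
    (hp : IsSiegelDelta (Fp L) L (IsCMField.complexConj L) (complexConj_imagUnit L) (imagUnit_ne_zero L) (imagUnit_mul_self L) v 2
      (gramR_isSymm L e dV hdV dW hdW) (hermD_eq_map_gramD L e dV hdV dW hdW) p)
    (B : GL (Fin (n' + n')) (v.adicCompletion (Fp L)))
    (hB : E' * iotaD (Fp L) L (IsCMField.complexConj L) (complexConj_imagUnit L) (imagUnit_ne_zero L) (imagUnit_mul_self L) v n'
        (gramR_isSymm L e' dV hdV (tensorFrame L dW eW dV') (tensorFrame_real L dW hdW eW dV' hdV'))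
        (hermD_eq_map_gramD L e' dV hdV (tensorFrame L dW eW dV') (tensorFrame_real L dW hdW eW dV' hdV'))
        (tensorEmbLoc L e dV hdV dW hdW eW e' dV' hdV' v p) * E'⁻¹ =
      transportSp (localGram (Fp L) (n' + n') (gramD (Fp L) n' (gramR L e' dV hdV (tensorFrame L dW eW dV') (tensorFrame_real L dW hdW eW dV' hdV'))) v) hTv (levi B))
    (x : Fin (n' + n') → v.adicCompletion (Fp L)) (j : Fin 2) (l : Fin 3) :
    halfDiff ((eD (Fp L) L (IsCMField.complexConj L) (complexConj_imagUnit L) (imagUnit_ne_zero L) (imagUnit_mul_self L) v n').symm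
        (toLin (Fp L) v E'⁻¹ ((B : Matrix (Fin (n' + n')) (Fin (n' + n')) (v.adicCompletion (Fp L))) *ᵥ x, 0))) (epsV e eW e' (j, l)) =
      ∑ j', blkD (matA (Fp L) L (IsCMField.complexConj L) v 2 p) j j' *
        halfDiff ((eD (Fp L) L (IsCMField.complexConj L) (complexConj_imagUnit L) (imagUnit_ne_zero L) (imagUnit_mul_self L) v n').symm
          (toLin (Fp L) v E'⁻¹ (x, 0))) (epsV e eW e' (j', l)) := by
  haveI : Algebra.IsQuadraticExtension (Fp L) L := IsCMField.isQuadraticExtension L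
  have hC : blkC (matA (Fp L) L (IsCMField.complexConj L) v n' (tensorEmbLoc L e dV hdV dW hdW eW e' dV' hdV' v p)) = 0 :=
    (isSiegelDelta_iff_blkC_eq_zero (Fp L) L (IsCMField.complexConj L) (complexConj_imagUnit L) (imagUnit_ne_zero L) (imagUnit_mul_self L) v n'
      (gramR_isSymm L e' dV hdV (tensorFrame L dW eW dV') (tensorFrame_real L dW hdW eW dV' hdV'))
      (hermD_eq_map_gramD L e' dV hdV (tensorFrame L dW eW dV') (tensorFrame_real L dW hdW eW dV' hdV')) _).1
      (isSiegelDelta_tensorEmbLoc L e dV hdV dW hdW eW e' dV' hdV' v hp)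
  have hD : blkD (matA (Fp L) L (IsCMField.complexConj L) v n' (tensorEmbLoc L e dV hdV dW hdW eW e' dV' hdV' v p)) =
      Matrix.reindex (epsV e eW e') (epsV e eW e') (blkD (matA (Fp L) L (IsCMField.complexConj L) v 2 p) ⊗ₖ (1 : Matrix (Fin 3) (Fin 3) (LocalRing L v))) := by
    rw [matA_tensorEmbLoc]
    exact (blk_reindex_kronecker (epsV e eW e') (matA (Fp L) L (IsCMField.complexConj L) v 2 p) (1 : Matrix (Fin 3) (Fin 3) (LocalRing L v))).2.2.2
  rw [toLin_inv_apply_levi_mulVec (Fp L) L (IsCMField.complexConj L) (complexConj_imagUnit L) (imagUnit_ne_zero L) (imagUnit_mul_self L) v n'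
      (gramR_isSymm L e' dV hdV (tensorFrame L dW eW dV') (tensorFrame_real L dW hdW eW dV' hdV'))
      (hermD_eq_map_gramD L e' dV hdV (tensorFrame L dW eW dV') (tensorFrame_real L dW hdW eW dV' hdV')) hTv E' _ B hB x,
    halfDiff_eD_symm_iotaD_of_blkC_eq_zero (Fp L) L (IsCMField.complexConj L) (complexConj_imagUnit L) (imagUnit_ne_zero L) (imagUnit_mul_self L) v n'
      (gramR_isSymm L e' dV hdV (tensorFrame L dW eW dV') (tensorFrame_real L dW hdW eW dV' hdV'))
      (hermD_eq_map_gramD L e' dV hdV (tensorFrame L dW eW dV') (tensorFrame_real L dW hdW eW dV' hdV')) _ hC, hD,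
    reindex_kronecker_one_mulVec_apply]

/-- **(C3-κ) THE LEVI ROW OF THE FRAME COORDINATE `κ`**: with the frame-coordinate letter (K1) of ★ (K-tot)∕★ (R-B″) (`P` invertible) and the transported-Levi
letter `hB` of ★ (C3-a) for `p ∈ P_Δ(U(𝕍□)_v)` at the tensor datum, for every `x ∈ X`:
`(κ(B·x)).1 = D·(κ x).1`, `(κ(B·x)).2.1 = D·(κ x).2.1`, `(κ(B·x)).2.2 = D·(κ x).2.2` with `D = (blkD (matA p))(w₀)` (the `Δ⁻`-block of `p` read at `w₀`).
[cite: Kudla1994, §3 Thm. 3.1] [cite: HarrisKudlaSweet1996, §1 (1.11), (1.15)] [cite: Rangarao1993, Lemma 3.2 (3.8)] -/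
theorem kappa_levi_rows
    (hTv : IsUnit (localGram (Fp L) (n' + n') (gramD (Fp L) n' (gramR L e' dV hdV (tensorFrame L dW eW dV') (tensorFrame_real L dW hdW eW dV' hdV'))) v).det)
    (E' : LocalSp (Fp L) (n' + n') (gramD (Fp L) n' (gramR L e' dV hdV (tensorFrame L dW eW dV') (tensorFrame_real L dW hdW eW dV' hdV'))) v)
    (P : Matrix (Fin 3) (Fin 3) (w₀.1.adicCompletion L)) (hPu : IsUnit P.det)
    (κ : (Fin (n' + n') → v.adicCompletion (Fp L)) ≃+ ((Fin 2 → w₀.1.adicCompletion L) × (Fin 2 → w₀.1.adicCompletion L) × (Fin 2 → w₀.1.adicCompletion L)))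
    (hK1 : ∀ (x : (Fin (n' + n') → v.adicCompletion (Fp L))) (j : Fin 2), ![(κ x).1 j, (κ x).2.1 j, (κ x).2.2 j] ᵥ* P = fun l => halfDiff ((eD (Fp L) L (IsCMField.complexConj L) (complexConj_imagUnit L) (imagUnit_ne_zero L) (imagUnit_mul_self L) v n').symm (toLin (Fp L) v E'⁻¹ (x, 0))) (epsV e eW e' (j, l)) w₀)
    (p : UnitaryGroup.localPi L (IsCMField.complexConj L) (2 + 2) (hermD L e dV hdV dW hdW) v)
    (hp : IsSiegelDelta (Fp L) L (IsCMField.complexConj L) (complexConj_imagUnit L) (imagUnit_ne_zero L) (imagUnit_mul_self L) v 2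
      (gramR_isSymm L e dV hdV dW hdW) (hermD_eq_map_gramD L e dV hdV dW hdW) p)
    (B : GL (Fin (n' + n')) (v.adicCompletion (Fp L)))
    (hB : E' * iotaD (Fp L) L (IsCMField.complexConj L) (complexConj_imagUnit L) (imagUnit_ne_zero L) (imagUnit_mul_self L) v n'
        (gramR_isSymm L e' dV hdV (tensorFrame L dW eW dV') (tensorFrame_real L dW hdW eW dV' hdV'))
        (hermD_eq_map_gramD L e' dV hdV (tensorFrame L dW eW dV') (tensorFrame_real L dW hdW eW dV' hdV'))
        (tensorEmbLoc L e dV hdV dW hdW eW e' dV' hdV' v p) * E'⁻¹ =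
      transportSp (localGram (Fp L) (n' + n') (gramD (Fp L) n' (gramR L e' dV hdV (tensorFrame L dW eW dV') (tensorFrame_real L dW hdW eW dV' hdV'))) v) hTv (levi B))
    (x : Fin (n' + n') → v.adicCompletion (Fp L)) :
    (κ ((B : Matrix (Fin (n' + n')) (Fin (n' + n')) (v.adicCompletion (Fp L))) *ᵥ x)).1 =
        (blkD (matA (Fp L) L (IsCMField.complexConj L) v 2 p)).map (fun z : LocalRing L v => z w₀) *ᵥ (κ x).1 ∧
      (κ ((B : Matrix (Fin (n' + n')) (Fin (n' + n')) (v.adicCompletion (Fp L))) *ᵥ x)).2.1 =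
        (blkD (matA (Fp L) L (IsCMField.complexConj L) v 2 p)).map (fun z : LocalRing L v => z w₀) *ᵥ (κ x).2.1 ∧
      (κ ((B : Matrix (Fin (n' + n')) (Fin (n' + n')) (v.adicCompletion (Fp L))) *ᵥ x)).2.2 =
        (blkD (matA (Fp L) L (IsCMField.complexConj L) v 2 p)).map (fun z : LocalRing L v => z w₀) *ᵥ (κ x).2.2 := by
  refine rows_eq_mulVec_of_reading (fun y => (κ y).1) (fun y => (κ y).2.1) (fun y => (κ y).2.2) P hPu
    (fun y j l => halfDiff ((eD (Fp L) L (IsCMField.complexConj L) (complexConj_imagUnit L) (imagUnit_ne_zero L) (imagUnit_mul_self L) v n').symm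
      (toLin (Fp L) v E'⁻¹ (y, 0))) (epsV e eW e' (j, l)) w₀) (fun y j => hK1 y j)
    ((blkD (matA (Fp L) L (IsCMField.complexConj L) v 2 p)).map (fun z : LocalRing L v => z w₀)) fun j l => ?_
  rw [halfDiff_reading_levi_mulVec L e dV hdV dW hdW eW e' dV' hdV' v hTv E' p hp B hB x j l, Finset.sum_apply]
  exact Finset.sum_congr rfl fun j' _ => by rw [Pi.mul_apply, Matrix.map_apply]

end Tensor

end Summit.HodgeConjecture.HodgeConjecture.Cruxes.HLiu418.K2LiuWitnessCoordinateLeviRow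

end
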